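import Literature.NumberTheory.LFunctions.WeilFirstPrimeOddMarginDataC
import Literature.NumberTheory.LFunctions.WeilBlockRows
import HarnessLib

/-!
# Odd-sector margin certificate C: dominance of rows 45–49 of `R = S'_odd(κ') − UᵀU`

Part of the odd-block check of `weilCertOddC` (`WeilFirstPrimeOddMarginDataC.lean`), evaluated by `decide +kernel`
row by row (`WeilCert.checkDomRow`, `WeilBlockRows.lean`) and kept in its own file for kernel time and memory.
Assembled in `WeilFirstPrimeOddMarginCCheck.lean`. Pure proof file; nothing is asserted.
-/

noncomputable section

namespace Literature.NumberTheory.LFunctions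

set_option maxHeartbeats 0 in
/-- Kernel check of the dominance of row 45 of `R = S'_odd(κ') − UᵀU` (certificate C). [folklore] -/
theorem checkDomRow1_45_weilCertOddC :
    weilCertOddC.base.checkDomRow weilCertOddC.nuTab weilCertOddCKappa' 1 45 = true := by
  decide +kernel

set_option maxHeartbeats 0 in
/-- Kernel check of the dominance of row 46 of `R = S'_odd(κ') − UᵀU` (certificate C). [folklore] -/
theorem checkDomRow1_46_weilCertOddC :
    weilCertOddC.base.checkDomRow weilCertOddC.nuTab weilCertOddCKappa' 1 46 = true := by
  decide +kernel

set_option maxHeartbeats 0 in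
/-- Kernel check of the dominance of row 47 of `R = S'_odd(κ') − UᵀU` (certificate C). [folklore] -/
theorem checkDomRow1_47_weilCertOddC :
    weilCertOddC.base.checkDomRow weilCertOddC.nuTab weilCertOddCKappa' 1 47 = true := by
  decide +kernel

set_option maxHeartbeats 0 in
/-- Kernel check of the dominance of row 48 of `R = S'_odd(κ') − UᵀU` (certificate C). [folklore] -/
theorem checkDomRow1_48_weilCertOddC :
    weilCertOddC.base.checkDomRow weilCertOddC.nuTab weilCertOddCKappa' 1 48 = true := by
  decide +kernel

set_option maxHeartbeats 0 in
/-- Kernel check of the dominance of row 49 of `R = S'_odd(κ') − UᵀU` (certificate C). [folklore] -/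
theorem checkDomRow1_49_weilCertOddC :
    weilCertOddC.base.checkDomRow weilCertOddC.nuTab weilCertOddCKappa' 1 49 = true := by
  decide +kernel

end Literature.NumberTheory.LFunctions
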